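import Summits.QuantumFields.YangMills.Theorems.UnitScaleTiltHalvingHSiteTopOfDatumGamma
import Summits.QuantumFields.YangMills.Theorems.UnitScaleTiltHalvingH59TLGammaOfSockB9Gamma
import Literature.MathematicalPhysics.QuantumFieldTheory.Balaban1983to89.B8Ineq159FlatOfScalarBdryBeta
import Literature.MathematicalPhysics.QuantumFieldTheory.Balaban1983to89.B8Ineq159FlatCubeMemberTransplantL3
import Literature.MathematicalPhysics.QuantumFieldTheory.Balaban1983to89.B8Ineq159FlatCubeMemberSCGamma
import HarnessLib

/-!
# Route `UnitScaleTilt`, crux K1 child «MinimiserStabilityRegPr» (stmt-QuantumFields-19200), registered stub `stub_halvingStep` (v10 `BirthV10`), line H, ROAD γ —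
# ★★ «(γ-6) H59-DISCHARGE»: THE DISPLAYED γ (1.59) ROWS AT THE FLAT BACKGROUND `U₀ = 1` ARE THEOREMS ON PRINT'S BIG-BLOCK SUB-LATTICE — `H59Dβm` (Theorem 4's
# two-member clause PER DATUM, `m = K − n − 1`, class `cubeLamBP′`; the binder of ✓`HalvingHSiteTopOfDatumGamma.siteTop_of_datum_γ` :197–213 VERBATIM) and `H59TLγ`
# (the top-level junction's conclusion, `m = K − n`, class `cubeLamBP`; the closure of ✓`HalvingH59TLGammaOfSockB9Gamma.H59TLγ_of_sockB9γAll` VERBATIM with print's p. 98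
# sub-lattice guards inserted after `ρ′ = ρ + M + L + S →`), DISCHARGED PER MEMBER from three lit theorems:
# lit ✓`B8Ineq159FlatCubeMemberTransplantL3.ineq159FlatCubeMemberPrinted_holds_L3` ([4] Thm 3.3 at `U = 1` on the Dirichlet cube over print's class, every odd `L ≥ 3`)
# → lit ✓`B8Ineq159FlatCubeMemberSCGamma.sc4_cubeMember_of_ineq159Printed` (the SCALAR four-line (1.59) clause, uniform on the sub-lattice)
# → lit ✓`B8Ineq159FlatOfScalarBdryBeta.flat159_clause_of_scalar_bdryβ` («⊗ id»: scalar ⟹ `M₂(ℂ)`-valued exponents `A′` with `W = e^{iηA′}`).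

Cell `ym3-torus` (HUMAN RULING D-0037: YM₃ on T³ is ladder rung R3 — NOT d = 4, NOT a mass gap, NOT the Clay problem), width seat `ym3-torus-px10` gen 3 (LEAD-H ★w5-19200 g6
H-NAMER WORD 28 «px10 g3: (γ-6) H59-DISCHARGE — GO»; LOCATE memo `LOCATE-GAMMA6-H59-DISCHARGE-px10g3.md` on HOME + 19200 evidence).  `--supports stmt-QuantumFields-19200 --as helper`;
THEOREMS ONLY (0 `def`, 0 `sorry`); count-neutral; nothing here claims `SB9γAllL`, the stub, the crux or the gap.

THE ONE WINDOW (located, print p. 98 «R₁M₁Lʲη»): the lit fact is uniform over cube data `(a, M′, ρ′, K − n)` with `∃ s R, M₀ ≤ L^{s+1} ∧ L^{s+1} ∣ ρ′ ∧ L^{s+1} ∣ M′ ∧ R·L^{s+1} ≤ ρ′ ∧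
R₀ ≤ R ∧ N₀ + 1 ≤ R·L^{s+1} ∧ ρ₀ ≤ ρ′` (thresholds `ρ₀ M₀ N₀ R₀` existential in the lit fact); off the sub-lattice only a per-cube constant exists (lit `sc4_cubeMember_inhabited`).  The rows'
constants `B₀`, `Bbd` are socket letters: both right-hand sides are monotone in them, so the discharge holds for EVERY `B₀ ≥ B⋆(L)`, `Bbd ≥ B⋆(L)`.

WHAT IS PROVED (sorry-free, no definition; ns `…Theorems.HalvingH59GammaDischargeFlat`):
* §1 `twoLine_mono` — the two-line β clause is monotone in `(B₀, Bbd)`.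
* §2 ★★ `H59Dβm_holds_member (L) (hL : 1 < L)` — `∃ B⋆ ρ₀ M₀ N₀ R₀, 1 ≤ B⋆ ∧ ∀ F (F.L = L) n K (n < K) (2 ≤ K − n) a M′ ρ′ s R ⟨window⟩ B₀ Bbd c⋆ (B⋆ ≤ B₀) (B⋆ ≤ Bbd) (0 ≤ c⋆ ≤ 1∕2) W,
  IsLandau138W … W → <the `H59Dβm` binder VERBATIM>`.
* §3 ★★ `H59TLγ_holds_member (M′ L) (hL) … (B⋆ ≤ B₀) (B⋆ ≤ Bbd)` — `<the H59TLγ closure VERBATIM, windowed>` (see §3's docstring).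

HONEST SCOPE.  By-name composition of three lit theorems; the (1.59) analysis is lit's ([4] Thm 3.3 at `U = 1`, kernel-checked there); the window is print's; nothing of Prop. 3 ∕ Thm 4 ∕
`SB9γAllL` ∕ `hSupUρ4` ∕ the stub ∕ the crux is asserted; YM₃ on T³ = rung R3 — not d = 4, not Clay, no mass gap.

References: T. Bałaban, CMP **99** (1985) 75–102 [Balaban1985RegularSpaces] ((1.58)–(1.59) p.86, (1.62) p.87, (1.31) p.82, (1.131) p.99, p.98, Thm 4 p.88); CMP **99** (1985) 389–434
[Balaban1985BackgroundPropagators] (Thm 3.3 p.399, (3.47) p.398, p.394 «⊗ identity»); CMP **96** (1984) 223–250 [Balaban1984PropagatorsII] ((2.3) p.224, Prop. 2.6 p.247).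
-/

set_option autoImplicit false

noncomputable section

open scoped BigOperators Matrix.Norms.L2Operator
open NormedSpace
open Complex (I)

namespace Summit.QuantumFields.YangMills.Theorems.HalvingH59GammaDischargeFlat

open Literature.MathematicalPhysics.QuantumFieldTheory.Balaban1983to89
open Literature.MathematicalPhysics.QuantumFieldTheory.Balaban1983to89.T3ContinuumYM3Torus
open Literature.MathematicalPhysics.QuantumFieldTheory.Balaban1983to89.T3PrintedRegularMinimiser (RegPr regFibrePr)
open B5Eq118OneStroke (iterBlockOf)
open B7Prop1Explicit (e)
open B7Prop1Explicit renaming Site → LSite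
open B7Prop2Explicit (unitaryUnits avgIter)
open B7Prop1Local (InBox loK bondHiK)
open B7Eq92Concrete (mgauge)
open B8Ineq130 (tlo thi)
open B8Ineq132 (covDerivFwd InAk BondTouches)
open B8Eq119TwistedAxial (Restr129 InAx)
open B8Eq131Cubes (tLo tHi)
open B8Eq131CubesAdmissible (cubeFam)
open B8CubeMemberZd (cubeLamS cubeLamB)
open B8Eq184Proof (cfgExp)
open B8Eq140Level (SideTouches)
open B8Eq146AExpansion (iEta)
open B8Eq138LandauZd (IsLandau138 IsLandau138W)
open B7Prop4GeneralLevels (linCovIter)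
open B8Eq155JBound (Jcur wsup wsup_nonneg)
open B8ScaledSupNorm (bondNorm msup msup_nonneg)
open B9SupplySockB9P3ZdBeta (CrossB)
open B9SupplySockB9P3ZdGamma (cubeLamBP')
open B8Ineq159FlatCubeMemberPrinted (cubeLamBP Ineq159FlatCubeMemberPrinted)
open B8Ineq159FlatCubeMemberTransplantL3 (ineq159FlatCubeMemberPrinted_holds_L3)
open B8Ineq159FlatCubeMemberSCGamma (sc4_cubeMember_of_ineq159Printed cubeLamBP_sub_splitIndex)
open B8Ineq159FlatOfScalarBdryBeta (flat159_clause_of_scalar_bdryβ)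
open B10Eq27TorusAxialLog (pull pull_apply unitsField toUField gaugeActT)
open B15Eq112TorusCover (cover)
open HalvingHSupURhoWindowsRho3 (exists_topCall_constants_of_rhoWindow₃)

/-! ## §1 Monotonicity of the two-line clause in the constants -/

/-- The right-hand side `B₀·(X + Y) + Bbd·Z` of the two-line (1.59) clause is monotone in `(B₀, Bbd)` when `X, Y, Z ≥ 0`. [folklore] -/
theorem twoLine_mono {P Q X Y Z B₀ B₀' Bbd Bbd' : ℝ} (hX : 0 ≤ X) (hY : 0 ≤ Y) (hZ : 0 ≤ Z) (hB : B₀ ≤ B₀') (hBd : Bbd ≤ Bbd')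
    (h : P ≤ B₀ * (X + Y) + Bbd * Z ∧ Q ≤ B₀ * (X + Y) + Bbd * Z) :
    P ≤ B₀' * (X + Y) + Bbd' * Z ∧ Q ≤ B₀' * (X + Y) + Bbd' * Z := by
  have h1 : B₀ * (X + Y) + Bbd * Z ≤ B₀' * (X + Y) + Bbd' * Z :=
    add_le_add (mul_le_mul_of_nonneg_right hB (add_nonneg hX hY)) (mul_le_mul_of_nonneg_right hBd hZ)
  exact ⟨h.1.trans h1, h.2.trans h1⟩

/-! ## §2 ★★ `H59Dβm` — Theorem 4's two-member (1.59) clause PER DATUM at the flat background, discharged on the sub-lattice -/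

/-- ★★ **«(γ-6)» THE ROW `H59Dβm` IS A THEOREM ON PRINT'S SUB-LATTICE**: for every `L > 1` there are `B⋆ ≥ 1` and thresholds `ρ₀ M₀ N₀ R₀` (lit's, [4] Thm 3.3 at `U = 1`) such that for
every member `F` (`F.L = L`), `n < K` with `2 ≤ K − n`, every cube datum `(a, M′, ρ′)` ON THE SUB-LATTICE (`L ≤ ρ′`, `M₀ ≤ L^{s+1}`, `L^{s+1} ∣ ρ′`, `L^{s+1} ∣ M′`, `R·L^{s+1} ≤ ρ′`,
`R₀ ≤ R`, `N₀ + 1 ≤ R·L^{s+1}`, `ρ₀ ≤ ρ′`), all constants `B₀, Bbd ≥ B⋆`, every exponent radius `0 ≤ c⋆ ≤ 1∕2` and every datum `W` in the flat Landau gauge at level `K − n − 1`,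
the binder `H59Dβm` of ✓`siteTop_of_datum_γ` holds VERBATIM.  Lit ✓`ineq159FlatCubeMemberPrinted_holds_L3` → ✓`sc4_cubeMember_of_ineq159Printed` (index ⊇ `cubeLamBP` by
✓`cubeLamBP_sub_splitIndex`) → §1 → ✓`flat159_clause_of_scalar_bdryβ`.
[cite: Balaban1985RegularSpaces, (1.58)-(1.59) p.86, (1.62) p.87, (1.31) p.82, p.98, Thm 4 p.88; Balaban1985BackgroundPropagators, Thm 3.3 p.399, (3.47) p.398; Balaban1984PropagatorsII, (2.3) p.224] -/
theorem H59Dβm_holds_member (L : ℕ) (hL : 1 < L) :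
    ∃ Bs ρ₀ M₀ : ℝ, ∃ N₀ R₀ : ℕ, 1 ≤ Bs ∧
    ∀ (F : T3Family), F.L = L → ∀ (n K : ℕ), n < K → 2 ≤ K - n →
    ∀ (a : LSite (F.P K).d) (M' ρ' s R : ℕ), L ≤ ρ' →
      M₀ ≤ (L : ℝ) ^ (s + 1) → L ^ (s + 1) ∣ ρ' → L ^ (s + 1) ∣ M' → R * L ^ (s + 1) ≤ ρ' → R₀ ≤ R → N₀ + 1 ≤ R * L ^ (s + 1) → ρ₀ ≤ (ρ' : ℝ) →
    ∀ (B₀ Bbd cstar : ℝ), Bs ≤ B₀ → Bs ≤ Bbd → 0 ≤ cstar → cstar ≤ 1 / 2 →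
    ∀ (W : LSite (F.P K).d → Fin (F.P K).d → (Matrix (Fin 2) (Fin 2) ℂ)ˣ),
      IsLandau138W (F.P K).L (K - n - 1) (((F.L : ℝ)⁻¹) ^ (K - n)) (cubeFam false (F.P K).L a M' ρ' (K - n) 0) (cubeLamS (F.P K).L a M' ρ' (K - n) (K - n - 1))
        (1 : LSite (F.P K).d → Fin (F.P K).d → (Matrix (Fin 2) (Fin 2) ℂ)ˣ) W →
      ∀ A' : LSite (F.P K).d → Fin (F.P K).d → (Matrix (Fin 2) (Fin 2) ℂ), (∀ y τ, IsSelfAdjoint (A' y τ)) →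
      (∀ j, j ≤ K - n - 1 → ∀ (y : LSite (F.P K).d) (τ : Fin (F.P K).d), SideTouches (cubeFam false (F.P K).L a M' ρ' (K - n) j) y τ →
      W y τ = cfgExp (((F.L : ℝ)⁻¹) ^ (K - n)) A' y τ ∧ ‖A' y τ‖ ≤ cstar * (((F.P K).L : ℝ) ^ j * (((F.L : ℝ)⁻¹) ^ (K - n)))⁻¹) →
      (∀ (y : LSite (F.P K).d) (τ : Fin (F.P K).d), (∀ j, j ≤ K - n - 1 → ¬ SideTouches (cubeFam false (F.P K).L a M' ρ' (K - n) j) y τ) → A' y τ = 0) →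
      msup (F.P K).L (K - n - 1) (((F.L : ℝ)⁻¹) ^ (K - n)) (-(1 : ℝ)) (fun j (b : LSite (F.P K).d × Fin (F.P K).d) => SideTouches (cubeFam false (F.P K).L a M' ρ' (K - n) j) b.1 b.2) (fun b => A' b.1 b.2)
      ≤ B₀ * (bondNorm (F.P K).L (K - n - 1) (((F.L : ℝ)⁻¹) ^ (K - n)) (-(3 : ℝ)) (cubeFam false (F.P K).L a M' ρ' (K - n)) (fun x μ => Jcur (((F.L : ℝ)⁻¹) ^ (K - n)) (1 : LSite (F.P K).d → Fin (F.P K).d → (Matrix (Fin 2) (Fin 2) ℂ)ˣ) A' μ x)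
      + wsup 1 (fun p : {p : ℕ × (LSite (F.P K).d × Fin (F.P K).d) // p.1 ≤ K - n - 1 ∧ (p.2 ∈ cubeLamBP' (F.P K).L a M' ρ' (K - n) (K - n - 1) p.1 ∨ (p.1 = 0 ∧ CrossB (cubeFam false (F.P K).L a M' ρ' (K - n) 0) p.2))} =>
      linCovIter (F.P K).L (1 : LSite (F.P K).d → Fin (F.P K).d → (Matrix (Fin 2) (Fin 2) ℂ)ˣ) (iEta (((F.L : ℝ)⁻¹) ^ (K - n)) A') p.1.1 p.1.2.1 p.1.2.2))
      + Bbd * msup (F.P K).L (K - n - 1) (((F.L : ℝ)⁻¹) ^ (K - n)) (-(1 : ℝ)) (fun j (b : LSite (F.P K).d × Fin (F.P K).d) => j = 0 ∧ SideTouches (cubeFam false (F.P K).L a M' ρ' (K - n) 0) b.1 b.2 ∧ ¬ BondTouches (cubeFam false (F.P K).L a M' ρ' (K - n) 0) b.1 b.2)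
      (fun b => A' b.1 b.2) ∧
      msup (F.P K).L (K - n - 1) (((F.L : ℝ)⁻¹) ^ (K - n)) (-(2 : ℝ)) (fun j (t : Fin (F.P K).d × Fin (F.P K).d × LSite (F.P K).d) => SideTouches (cubeFam false (F.P K).L a M' ρ' (K - n) j) t.2.2 t.2.1)
      (fun t => covDerivFwd (((F.L : ℝ)⁻¹) ^ (K - n)) (1 : LSite (F.P K).d → Fin (F.P K).d → (Matrix (Fin 2) (Fin 2) ℂ)ˣ) t.1 (fun z => A' z t.2.1) t.2.2)
      ≤ B₀ * (bondNorm (F.P K).L (K - n - 1) (((F.L : ℝ)⁻¹) ^ (K - n)) (-(3 : ℝ)) (cubeFam false (F.P K).L a M' ρ' (K - n)) (fun x μ => Jcur (((F.L : ℝ)⁻¹) ^ (K - n)) (1 : LSite (F.P K).d → Fin (F.P K).d → (Matrix (Fin 2) (Fin 2) ℂ)ˣ) A' μ x)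
      + wsup 1 (fun p : {p : ℕ × (LSite (F.P K).d × Fin (F.P K).d) // p.1 ≤ K - n - 1 ∧ (p.2 ∈ cubeLamBP' (F.P K).L a M' ρ' (K - n) (K - n - 1) p.1 ∨ (p.1 = 0 ∧ CrossB (cubeFam false (F.P K).L a M' ρ' (K - n) 0) p.2))} =>
      linCovIter (F.P K).L (1 : LSite (F.P K).d → Fin (F.P K).d → (Matrix (Fin 2) (Fin 2) ℂ)ˣ) (iEta (((F.L : ℝ)⁻¹) ^ (K - n)) A') p.1.1 p.1.2.1 p.1.2.2))
      + Bbd * msup (F.P K).L (K - n - 1) (((F.L : ℝ)⁻¹) ^ (K - n)) (-(1 : ℝ)) (fun j (b : LSite (F.P K).d × Fin (F.P K).d) => j = 0 ∧ SideTouches (cubeFam false (F.P K).L a M' ρ' (K - n) 0) b.1 b.2 ∧ ¬ BondTouches (cubeFam false (F.P K).L a M' ρ' (K - n) 0) b.1 b.2)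
      (fun b => A' b.1 b.2) := by
  classical
  have hL1 : 1 ≤ L := hL.le
  by_cases hodd : Odd L
  · -- the lit fact at `(d, L) = (3, L)` and its scalar four-line clause, constants uniform on the sub-lattice
    obtain ⟨ℓ, hℓ⟩ : ∃ ℓ, L = ℓ + 1 := ⟨L - 1, by omega⟩
    have h159 : Ineq159FlatCubeMemberPrinted 3 L := by
      rw [hℓ]; exact ineq159FlatCubeMemberPrinted_holds_L3 2 ℓ (by omega) (hℓ ▸ hodd)
    obtain ⟨B₀l, ρ₀, M₀, N₀, R₀, hB₀l, H⟩ := sc4_cubeMember_of_ineq159Printed (d := 3) (by norm_num) hL1 h159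
    refine ⟨B₀l, ρ₀, M₀, N₀, R₀, hB₀l, ?_⟩
    intro F hF n K hnK h2 a M' ρ' s R hρL hM₀ hdρ hdM hRρ hR₀ hN₀ hρ₀ B₀ Bbd cstar hB hBbd hc0 hc W hLan A' _hsa hWA hA0
    subst hF
    have hLF : (F.P K).L = F.L := rfl
    have hη : 0 < ((F.L : ℝ)⁻¹) ^ (K - n) := by
      have hL0 : (0 : ℝ) < F.L := by exact_mod_cast (F.P K).L_pos
      positivity
    have hk : 1 ≤ K - n := by omega
    have hm1 : 1 ≤ K - n - 1 := by omega
    have hmk : K - n - 1 ≤ K - n := Nat.sub_le _ _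
    have hρ1 : 1 ≤ ρ' := le_trans hL1 hρL
    -- the scalar two lines at `(B₀l, B₀l)` over the split index, then monotone up to `(B₀, Bbd)`
    have hI := cubeLamBP_sub_splitIndex (d := (F.P K).d) hL1 a M' hρ1 hm1 hmk
    have SCALAR : ∀ φ : LSite (F.P K).d → Fin (F.P K).d → ℂ,
        IsLandau138 (F.P K).L (K - n - 1) (((F.L : ℝ)⁻¹) ^ (K - n)) ((fun j => cubeFam false (F.P K).L a M' ρ' (K - n) j) 0)
          (cubeLamS (F.P K).L a M' ρ' (K - n) (K - n - 1)) (1 : LSite (F.P K).d → Fin (F.P K).d → ℂˣ) φ →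
        (∀ (y : LSite (F.P K).d) (τ : Fin (F.P K).d), (∀ j, j ≤ K - n - 1 → ¬ SideTouches ((fun j => cubeFam false (F.P K).L a M' ρ' (K - n) j) j) y τ) → φ y τ = 0) →
        msup (F.P K).L (K - n - 1) (((F.L : ℝ)⁻¹) ^ (K - n)) (-(1 : ℝ)) (fun j (b : LSite (F.P K).d × Fin (F.P K).d) => SideTouches ((fun j => cubeFam false (F.P K).L a M' ρ' (K - n) j) j) b.1 b.2) (fun b => φ b.1 b.2)
            ≤ B₀ * (bondNorm (F.P K).L (K - n - 1) (((F.L : ℝ)⁻¹) ^ (K - n)) (-(3 : ℝ)) (fun j => cubeFam false (F.P K).L a M' ρ' (K - n) j) (fun x μ => Jcur (((F.L : ℝ)⁻¹) ^ (K - n)) (1 : LSite (F.P K).d → Fin (F.P K).d → ℂˣ) φ μ x)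
              + wsup 1 (fun p : {p : ℕ × (LSite (F.P K).d × Fin (F.P K).d) // p.1 ≤ K - n - 1 ∧ (p.2 ∈ (fun j => cubeLamBP' (F.P K).L a M' ρ' (K - n) (K - n - 1) j) p.1 ∨ (p.1 = 0 ∧ CrossB ((fun j => cubeFam false (F.P K).L a M' ρ' (K - n) j) 0) p.2))} =>
                  linCovIter (F.P K).L (1 : LSite (F.P K).d → Fin (F.P K).d → ℂˣ) (iEta (((F.L : ℝ)⁻¹) ^ (K - n)) φ) p.1.1 p.1.2.1 p.1.2.2))
              + Bbd * msup (F.P K).L (K - n - 1) (((F.L : ℝ)⁻¹) ^ (K - n)) (-(1 : ℝ)) (fun j (b : LSite (F.P K).d × Fin (F.P K).d) => j = 0 ∧ SideTouches ((fun j => cubeFam false (F.P K).L a M' ρ' (K - n) j) 0) b.1 b.2 ∧ ¬ BondTouches ((fun j => cubeFam false (F.P K).L a M' ρ' (K - n) j) 0) b.1 b.2)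
                  (fun b => φ b.1 b.2) ∧
          msup (F.P K).L (K - n - 1) (((F.L : ℝ)⁻¹) ^ (K - n)) (-(2 : ℝ)) (fun j (t : Fin (F.P K).d × Fin (F.P K).d × LSite (F.P K).d) => SideTouches ((fun j => cubeFam false (F.P K).L a M' ρ' (K - n) j) j) t.2.2 t.2.1)
              (fun t => covDerivFwd (((F.L : ℝ)⁻¹) ^ (K - n)) (1 : LSite (F.P K).d → Fin (F.P K).d → ℂˣ) t.1 (fun z => φ z t.2.1) t.2.2)
            ≤ B₀ * (bondNorm (F.P K).L (K - n - 1) (((F.L : ℝ)⁻¹) ^ (K - n)) (-(3 : ℝ)) (fun j => cubeFam false (F.P K).L a M' ρ' (K - n) j) (fun x μ => Jcur (((F.L : ℝ)⁻¹) ^ (K - n)) (1 : LSite (F.P K).d → Fin (F.P K).d → ℂˣ) φ μ x)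
              + wsup 1 (fun p : {p : ℕ × (LSite (F.P K).d × Fin (F.P K).d) // p.1 ≤ K - n - 1 ∧ (p.2 ∈ (fun j => cubeLamBP' (F.P K).L a M' ρ' (K - n) (K - n - 1) j) p.1 ∨ (p.1 = 0 ∧ CrossB ((fun j => cubeFam false (F.P K).L a M' ρ' (K - n) j) 0) p.2))} =>
                  linCovIter (F.P K).L (1 : LSite (F.P K).d → Fin (F.P K).d → ℂˣ) (iEta (((F.L : ℝ)⁻¹) ^ (K - n)) φ) p.1.1 p.1.2.1 p.1.2.2))
              + Bbd * msup (F.P K).L (K - n - 1) (((F.L : ℝ)⁻¹) ^ (K - n)) (-(1 : ℝ)) (fun j (b : LSite (F.P K).d × Fin (F.P K).d) => j = 0 ∧ SideTouches ((fun j => cubeFam false (F.P K).L a M' ρ' (K - n) j) 0) b.1 b.2 ∧ ¬ BondTouches ((fun j => cubeFam false (F.P K).L a M' ρ' (K - n) j) 0) b.1 b.2)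
                  (fun b => φ b.1 b.2) := by
      intro φ hLanφ hsuppφ
      obtain ⟨q1, q2, -, -⟩ := H _ hη a M' ρ' (K - n) s R hk hρL hM₀ hdρ hdM hRρ hR₀ hN₀ hρ₀ (K - n - 1) hm1 hmk
        (fun j c => c ∈ cubeLamBP' (F.P K).L a M' ρ' (K - n) (K - n - 1) j ∨ (j = 0 ∧ CrossB (cubeFam false (F.P K).L a M' ρ' (K - n) 0) c)) hI φ hLanφ hsuppφ
      exact twoLine_mono (msup_nonneg _ _ hη.le _ _ _) (wsup_nonneg zero_le_one _) (msup_nonneg _ _ hη.le _ _ _) hB hBbd ⟨q1, q2⟩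
    exact flat159_clause_of_scalar_bdryβ (𝔸 := Matrix (Fin 2) (Fin 2) ℂ) (d := (F.P K).d) (by rw [T3Family.P_d]; norm_num) hL1 hη (K - n - 1)
      (fun j => cubeFam false (F.P K).L a M' ρ' (K - n) j) (cubeLamS (F.P K).L a M' ρ' (K - n) (K - n - 1))
      (fun j => cubeLamBP' (F.P K).L a M' ρ' (K - n) (K - n - 1) j) (le_trans zero_le_one (hB₀l.trans hB)) (le_trans zero_le_one (hB₀l.trans hBbd)) hc0 hc
      SCALAR W A' hLan hWA hA0
  · -- no member has an even `L`
    refine ⟨1, 0, 0, 0, 0, le_rfl, ?_⟩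
    intro F hF
    exact absurd (hF ▸ F.hL.1) hodd


/-! ## §3 ★★ `H59TLγ` — the top-level junction's (1.59) conclusion at the flat background, discharged on the sub-lattice -/

/-- ★★ **«(γ-6)» THE ROW `H59TLγ` IS A THEOREM ON PRINT'S SUB-LATTICE**: for every `L > 1` there are `B⋆ ≥ 1` and thresholds `ρ₀ M₀ N₀ R₀` (lit's) such that for every `M′`, all socket
letters `B₀, Bbd ≥ B⋆`, `0 < B₀'H`, `0 ≤ B₂' BG BR`, `0 < cB9`, the closure `H59TLγ` of ✓`H59TLγ_of_sockB9γAll` holds VERBATIM with the seven sub-lattice guards on `(M′, ρ′)` inserted after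
`ρ′ = ρ + M + L + S →` — WITHOUT the socket `SB9γAllL`.  The exponent radius `c = 2((F.P K).L·c⋆) + 8α₄ ≤ 1∕16` comes from the member's own smallness `hw`
(✓`exists_topCall_constants_of_rhoWindow₃` (2), letters identified as in ✓`H59TLγ_of_sockB9γAll`); Landau = `hLan.1`; the guards `u`∕support∕`Restr129`∕comb∕`InAx`∕tower∕`IsSelfAdjoint` are idle.
Lit ✓`ineq159FlatCubeMemberPrinted_holds_L3` → ✓`sc4_cubeMember_of_ineq159Printed` → §1 → ✓`flat159_clause_of_scalar_bdryβ`.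
[cite: Balaban1985RegularSpaces, (1.58)-(1.59) p.86, (1.62) p.87, (1.31) p.82, p.98, Prop. 3 p.87; Balaban1985BackgroundPropagators, Thm 3.3 p.399, (3.47) p.398; Balaban1984PropagatorsII, (2.3) p.224] -/
theorem H59TLγ_holds_member (L : ℕ) (hL : 1 < L) :
    ∃ Bs ρ₀ M₀ : ℝ, ∃ N₀ R₀ : ℕ, 1 ≤ Bs ∧
    ∀ (M' : ℕ) (B₀ B₀'H B₂' BG BR cB9 Bbd : ℝ), Bs ≤ B₀ → Bs ≤ Bbd → 0 < B₀'H → 0 ≤ B₂' → 0 ≤ BG → 0 ≤ BR → 0 < cB9 →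
    (∀ (F : T3Family), F.L = L → ∀ (n K : ℕ) (hnK : n < K) (ρ S M ρ' : ℕ), ρ' = ρ + M + L + S →
      -- THE SUB-LATTICE WINDOW (print p. 98): the cube datum `(M′, ρ′)` on the big-block sub-lattice of the lit thresholds `ρ₀ M₀ N₀ R₀`
      ∀ (sx Rx : ℕ), M₀ ≤ (L : ℝ) ^ (sx + 1) → L ^ (sx + 1) ∣ ρ' → L ^ (sx + 1) ∣ M' → Rx * L ^ (sx + 1) ≤ ρ' → R₀ ≤ Rx → N₀ + 1 ≤ Rx * L ^ (sx + 1) → ρ₀ ≤ (ρ' : ℝ) →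
      1 ≤ M → 2 ≤ S →
      ∀ (a₅ Cr ε₀ ε₁ : ℝ), 0 < Cr → 4 < Cr → 12 * ((ρ : ℝ) + (M : ℝ)) * a₅ ≤ Cr → 0 < ε₁ → 0 < ε₀ → ε₀ ≤ a₅ → Cr * ε₁ ≤ ε₀ →
      (10 : ℝ) ^ 29 * (L : ℝ) ^ 12 * (1 + B₀ + B₀⁻¹) ^ 2 * ((1 + B₀'H) * (1 + B₂') * (1 + BG) * (1 + BR)) ^ 5 * (1 + cB9⁻¹) *
      ((((ρ + M + L + S : ℕ) : ℝ) + (M' : ℝ) + 1) ^ 3 * ε₀) ≤ 1 →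
      2 * ρ + (M' + 1 + 2 * (M + L + S)) ≤ F.L ^ (F.m + n) →
      ∀ (V : GaugeField (F.P n) 0 (Matrix.specialUnitaryGroup (Fin 2) ℂ)), PlaqSmall ε₁ V → ∀ U ∈ regFibrePr F n K hnK.le ε₀ V,
      ∀ (x₀ : Site (F.P K) 0) (t : ℤ), 0 ≤ t → t ≤ (M' : ℤ) - 1 →
      ∀ (a : LSite (F.P K).d), a = (fun μ => ((iterBlockOf (K - n) x₀ μ).val : ℤ) - t) →
      ∀ (α₁ α₄ cstar : ℝ), α₁ = 198 * (((ρ' : ℝ) + M' + 1) * ε₀) + 27 * (((ρ' : ℝ) + M' + 1) * ε₀) / ((L : ℝ) * B₀) →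
      cstar = 5 * (F.P K).d * (F.P K).L * B₀ * (ε₀ + α₁) →
      α₄ = 8 * (300 * (L : ℝ) * ((3 * (M' + ρ') + 1 : ℕ) : ℝ) * (B₀'H + 15 * (L : ℝ) ^ 2 * BG * BR + 3 * BG * BR * B₂')) * (5 * ((3 : ℕ) : ℝ) * L * B₀) * (ε₀ + α₁) →
      ∀ (s : ℝ), s = (198 + 12 * (((M' : ℝ) - 1) + 4 * ρ')) * ε₀ →
      ∀ (gJ : GaugeTransf (F.P K) 0 (Matrix.specialUnitaryGroup (Fin 2) ℂ)),
      InAk (F.P K).L (K - n) (((F.L : ℝ)⁻¹) ^ (K - n)) ε₀ (fun _ => (Set.univ : Set (LSite (F.P K).d))) (pull (unitsField (toUField (GaugeField.gaugeAct gJ U))) 0) →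
      (∀ m', m' ≤ K - n → ∀ Λ : ℕ → Set (LSite (F.P K).d), InAx (F.P K).L m' Λ (1 : LSite (F.P K).d → Fin (F.P K).d → (Matrix (Fin 2) (Fin 2) ℂ)ˣ) (pull (unitsField (toUField (GaugeField.gaugeAct gJ U))) 0)) →
      (∀ m', m' ≤ K - n → ∀ (x : LSite (F.P K).d) (ν : Fin (F.P K).d), tlo (F.P K).L (tLo a ρ') m' ≤ x → x + e ν ≤ thi (F.P K).L (tHi a M' ρ') m' →
      ‖((avgIter (F.P K).L (pull (unitsField (toUField (GaugeField.gaugeAct gJ U))) 0) (K - n - m') x ν : (Matrix (Fin 2) (Fin 2) ℂ)ˣ) :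
      Matrix (Fin 2) (Fin 2) ℂ) - 1‖ < s) →
      ∀ (g' : GaugeTransf (F.P K) 0 (Matrix (Fin 2) (Fin 2) ℂ)ˣ) (u : LSite (F.P K).d → (Matrix (Fin 2) (Fin 2) ℂ)ˣ) (V' : LSite (F.P K).d → Fin (F.P K).d → (Matrix (Fin 2) (Fin 2) ℂ)ˣ)
      (A' : LSite (F.P K).d → Fin (F.P K).d → (Matrix (Fin 2) (Fin 2) ℂ)),
      (∀ x, u x ∈ unitaryUnits (Matrix (Fin 2) (Fin 2) ℂ)) → (∀ x, x ∉ (cubeFam false (F.P K).L a M' ρ' (K - n)) 0 → u x = 1) →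
      mgauge (1 : LSite (F.P K).d → Fin (F.P K).d → (Matrix (Fin 2) (Fin 2) ℂ)ˣ) u V' = (pull (unitsField (toUField (GaugeField.gaugeAct gJ U))) 0) →
      Restr129 (F.P K).L (K - n) (Function.update (cubeLamS (F.P K).L a M' ρ' (K - n) (K - n)) (K - n) ∅) (1 : LSite (F.P K).d → Fin (F.P K).d → (Matrix (Fin 2) (Fin 2) ℂ)ˣ) u →
      (IsLandau138W (F.P K).L (K - n) (((F.L : ℝ)⁻¹) ^ (K - n)) ((cubeFam false (F.P K).L a M' ρ' (K - n)) 0) (cubeLamS (F.P K).L a M' ρ' (K - n) (K - n)) (1 : LSite (F.P K).d → Fin (F.P K).d → (Matrix (Fin 2) (Fin 2) ℂ)ˣ) V' ∧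
      (∀ c ∈ (cubeLamB (F.P K).L a M' ρ' (K - n) (K - n)) (K - n), ∀ (y : LSite (F.P K).d) (τ : Fin (F.P K).d),
      InBox (loK (F.P K).L (K - n) c.1) (bondHiK (F.P K).L (K - n) c.1 c.2) y → InBox (loK (F.P K).L (K - n) c.1) (bondHiK (F.P K).L (K - n) c.1 c.2) (y + e τ) →
      V' y τ = gaugeActT g' (unitsField (toUField U)) ⟨cover (F.P K) y, τ⟩)) →
      (∀ y τ, IsSelfAdjoint (A' y τ)) →
      (∀ j, j ≤ K - n → ∀ y τ, SideTouches ((cubeFam false (F.P K).L a M' ρ' (K - n)) j) y τ →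
      V' y τ = cfgExp (((F.L : ℝ)⁻¹) ^ (K - n)) A' y τ ∧ ‖A' y τ‖ ≤ (2 * ((F.P K).L * cstar) + 8 * α₄) * (((F.P K).L : ℝ) ^ j * (((F.L : ℝ)⁻¹) ^ (K - n)))⁻¹) →
      (∀ y τ, (∀ j, j ≤ K - n → ¬ SideTouches ((cubeFam false (F.P K).L a M' ρ' (K - n)) j) y τ) → A' y τ = 0) →
      msup (F.P K).L (K - n) (((F.L : ℝ)⁻¹) ^ (K - n)) (-(1 : ℝ)) (fun j (b : LSite (F.P K).d × Fin (F.P K).d) => SideTouches ((cubeFam false (F.P K).L a M' ρ' (K - n)) j) b.1 b.2) (fun b => A' b.1 b.2)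
      ≤ B₀ * (bondNorm (F.P K).L (K - n) (((F.L : ℝ)⁻¹) ^ (K - n)) (-(3 : ℝ)) (cubeFam false (F.P K).L a M' ρ' (K - n)) (fun x μ => Jcur (((F.L : ℝ)⁻¹) ^ (K - n)) (1 : LSite (F.P K).d → Fin (F.P K).d → (Matrix (Fin 2) (Fin 2) ℂ)ˣ) A' μ x)
      + wsup 1 (fun p : {p : ℕ × (LSite (F.P K).d × Fin (F.P K).d) // p.1 ≤ K - n ∧ (p.2 ∈ (cubeLamBP (F.P K).L a M' ρ' (K - n) (K - n)) p.1 ∨ (p.1 = 0 ∧ CrossB ((cubeFam false (F.P K).L a M' ρ' (K - n)) 0) p.2))} =>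
      linCovIter (F.P K).L (1 : LSite (F.P K).d → Fin (F.P K).d → (Matrix (Fin 2) (Fin 2) ℂ)ˣ) (iEta (((F.L : ℝ)⁻¹) ^ (K - n)) A') p.1.1 p.1.2.1 p.1.2.2))
      + Bbd * msup (F.P K).L (K - n) (((F.L : ℝ)⁻¹) ^ (K - n)) (-(1 : ℝ)) (fun j (b : LSite (F.P K).d × Fin (F.P K).d) => j = 0 ∧ SideTouches ((cubeFam false (F.P K).L a M' ρ' (K - n)) 0) b.1 b.2 ∧ ¬ BondTouches ((cubeFam false (F.P K).L a M' ρ' (K - n)) 0) b.1 b.2) (fun b => A' b.1 b.2) ∧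
      msup (F.P K).L (K - n) (((F.L : ℝ)⁻¹) ^ (K - n)) (-(2 : ℝ)) (fun j (t : Fin (F.P K).d × Fin (F.P K).d × LSite (F.P K).d) => SideTouches ((cubeFam false (F.P K).L a M' ρ' (K - n)) j) t.2.2 t.2.1)
      (fun t => covDerivFwd (((F.L : ℝ)⁻¹) ^ (K - n)) (1 : LSite (F.P K).d → Fin (F.P K).d → (Matrix (Fin 2) (Fin 2) ℂ)ˣ) t.1 (fun z => A' z t.2.1) t.2.2)
      ≤ B₀ * (bondNorm (F.P K).L (K - n) (((F.L : ℝ)⁻¹) ^ (K - n)) (-(3 : ℝ)) (cubeFam false (F.P K).L a M' ρ' (K - n)) (fun x μ => Jcur (((F.L : ℝ)⁻¹) ^ (K - n)) (1 : LSite (F.P K).d → Fin (F.P K).d → (Matrix (Fin 2) (Fin 2) ℂ)ˣ) A' μ x)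
      + wsup 1 (fun p : {p : ℕ × (LSite (F.P K).d × Fin (F.P K).d) // p.1 ≤ K - n ∧ (p.2 ∈ (cubeLamBP (F.P K).L a M' ρ' (K - n) (K - n)) p.1 ∨ (p.1 = 0 ∧ CrossB ((cubeFam false (F.P K).L a M' ρ' (K - n)) 0) p.2))} =>
      linCovIter (F.P K).L (1 : LSite (F.P K).d → Fin (F.P K).d → (Matrix (Fin 2) (Fin 2) ℂ)ˣ) (iEta (((F.L : ℝ)⁻¹) ^ (K - n)) A') p.1.1 p.1.2.1 p.1.2.2))
      + Bbd * msup (F.P K).L (K - n) (((F.L : ℝ)⁻¹) ^ (K - n)) (-(1 : ℝ)) (fun j (b : LSite (F.P K).d × Fin (F.P K).d) => j = 0 ∧ SideTouches ((cubeFam false (F.P K).L a M' ρ' (K - n)) 0) b.1 b.2 ∧ ¬ BondTouches ((cubeFam false (F.P K).L a M' ρ' (K - n)) 0) b.1 b.2) (fun b => A' b.1 b.2)) := by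
  classical
  have hL1 : 1 ≤ L := hL.le
  by_cases hodd : Odd L
  · -- the lit fact at `(d, L) = (3, L)` and its scalar four-line clause, constants uniform on the sub-lattice
    obtain ⟨ℓ, hℓ⟩ : ∃ ℓ, L = ℓ + 1 := ⟨L - 1, by omega⟩
    have h159 : Ineq159FlatCubeMemberPrinted 3 L := by
      rw [hℓ]; exact ineq159FlatCubeMemberPrinted_holds_L3 2 ℓ (by omega) (hℓ ▸ hodd)
    obtain ⟨B₀l, ρ₀, M₀, N₀, R₀, hB₀l, H⟩ := sc4_cubeMember_of_ineq159Printed (d := 3) (by norm_num) hL1 h159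
    refine ⟨B₀l, ρ₀, M₀, N₀, R₀, hB₀l, ?_⟩
    intro M' B₀ B₀'H B₂' BG BR cB9 Bbd hB hBbd hB₀'H hB₂' hBG hBR hcB9 F hF n K hnK ρ S M ρ' hρ'def sx Rx hM₀ hdρ hdM hRρ hR₀ hN₀ hρ₀ _hM _hS a₅ Cr ε₀ ε₁ _hCr _hCr4
      _h12 _hε₁ hε₀ _hε₀a _hCrε hw _hroom V _hV U _hU x₀ t _ht0 _ht a _hadef α₁ α₄ cstar hα₁def hcdef hα₄def s _hsdef gJ _hInAk _hInAx _htw g' u V' A' _hu _huS _hW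
      _h129 hLan _hsa h41 h0
    -- letters of the member
    have hd3 : (F.P K).d = 3 := T3Family.P_d F K
    have hLF : (F.P K).L = F.L := rfl
    have hL2P : 2 ≤ (F.P K).L := by rw [hLF, hF]; omega
    have hLr : ((F.P K).L : ℝ) = (L : ℝ) := by rw [hLF, hF]
    have hη : 0 < ((F.L : ℝ)⁻¹) ^ (K - n) := by
      have hL0 : (0 : ℝ) < F.L := by exact_mod_cast (F.P K).L_pos
      positivity
    have hB₀ : 0 < B₀ := lt_of_lt_of_le one_pos (hB₀l.trans hB)
    -- the window tuple from the member's own smallness: `16·(2(L·c⋆) + 8α₄) ≤ 1`, `0 ≤ c⋆`, `0 ≤ α₄`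
    have hw' := hw
    rw [← hLr] at hw'
    subst hρ'def
    obtain ⟨m₀, α₀, α₁', a₆₆, cstar', B₀', α₄', C₂, cB, cA, cDA, c', σ, δ, ω, Cb, Cl, τ₀, e0, eα₀, ea, e1, ec, eB, e4, eC, ecB, ecA, ecDA, ecp, eσ, eδ, eω, eτ₀,
      ⟨-, -, -, -, -, -, -, hα₄0, -, -, hc0', -⟩, ⟨-, -, -, -, -, -, h16, -⟩, -, -⟩ :=
      exists_topCall_constants_of_rhoWindow₃ (F.P K).d (F.P K).L hd3 hL2P hB₀ hB₀'H hB₂' hBG hBR hcB9 M' (ρ + M + L + S) hε₀ hw'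
    have hα₁E : α₁ = α₁' := by rw [hα₁def, e1, hLr]
    have hcE : cstar = cstar' := by rw [hcdef, ec, eα₀, hα₁E]
    have hα₄E : α₄ = α₄' := by rw [hα₄def, e4, eB, e0, eα₀, hα₁E, hd3, hLr]
    rw [← hcE, ← hα₄E] at h16
    rw [← hcE] at hc0'
    rw [← hα₄E] at hα₄0
    have hLP0 : (0 : ℝ) ≤ ((F.P K).L : ℝ) := Nat.cast_nonneg _
    have hc0 : 0 ≤ 2 * ((F.P K).L * cstar) + 8 * α₄ := by
      have h1 : 0 ≤ ((F.P K).L : ℝ) * cstar := mul_nonneg hLP0 hc0'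
      linarith only [h1, hα₄0]
    have hc : 2 * ((F.P K).L * cstar) + 8 * α₄ ≤ 1 / 2 := by linarith only [h16, hc0]
    -- align `L` with the member's letter
    subst hF
    have hk : 1 ≤ K - n := by omega
    have hρL : F.L ≤ ρ + M + F.L + S := by omega
    -- the scalar two lines at `(B₀l, B₀l)` over the index `cubeLamBP ∨ CrossB`, then monotone up to `(B₀, Bbd)`
    have SCALAR : ∀ φ : LSite (F.P K).d → Fin (F.P K).d → ℂ,
        IsLandau138 (F.P K).L (K - n) (((F.L : ℝ)⁻¹) ^ (K - n)) ((fun j => cubeFam false (F.P K).L a M' (ρ + M + F.L + S) (K - n) j) 0)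
          (cubeLamS (F.P K).L a M' (ρ + M + F.L + S) (K - n) (K - n)) (1 : LSite (F.P K).d → Fin (F.P K).d → ℂˣ) φ →
        (∀ (y : LSite (F.P K).d) (τ : Fin (F.P K).d), (∀ j, j ≤ K - n → ¬ SideTouches ((fun j => cubeFam false (F.P K).L a M' (ρ + M + F.L + S) (K - n) j) j) y τ) → φ y τ = 0) →
        msup (F.P K).L (K - n) (((F.L : ℝ)⁻¹) ^ (K - n)) (-(1 : ℝ)) (fun j (b : LSite (F.P K).d × Fin (F.P K).d) => SideTouches ((fun j => cubeFam false (F.P K).L a M' (ρ + M + F.L + S) (K - n) j) j) b.1 b.2) (fun b => φ b.1 b.2)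
            ≤ B₀ * (bondNorm (F.P K).L (K - n) (((F.L : ℝ)⁻¹) ^ (K - n)) (-(3 : ℝ)) (fun j => cubeFam false (F.P K).L a M' (ρ + M + F.L + S) (K - n) j) (fun x μ => Jcur (((F.L : ℝ)⁻¹) ^ (K - n)) (1 : LSite (F.P K).d → Fin (F.P K).d → ℂˣ) φ μ x)
              + wsup 1 (fun p : {p : ℕ × (LSite (F.P K).d × Fin (F.P K).d) // p.1 ≤ K - n ∧ (p.2 ∈ (fun j => cubeLamBP (F.P K).L a M' (ρ + M + F.L + S) (K - n) (K - n) j) p.1 ∨ (p.1 = 0 ∧ CrossB ((fun j => cubeFam false (F.P K).L a M' (ρ + M + F.L + S) (K - n) j) 0) p.2))} =>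
                  linCovIter (F.P K).L (1 : LSite (F.P K).d → Fin (F.P K).d → ℂˣ) (iEta (((F.L : ℝ)⁻¹) ^ (K - n)) φ) p.1.1 p.1.2.1 p.1.2.2))
              + Bbd * msup (F.P K).L (K - n) (((F.L : ℝ)⁻¹) ^ (K - n)) (-(1 : ℝ)) (fun j (b : LSite (F.P K).d × Fin (F.P K).d) => j = 0 ∧ SideTouches ((fun j => cubeFam false (F.P K).L a M' (ρ + M + F.L + S) (K - n) j) 0) b.1 b.2 ∧ ¬ BondTouches ((fun j => cubeFam false (F.P K).L a M' (ρ + M + F.L + S) (K - n) j) 0) b.1 b.2)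
                  (fun b => φ b.1 b.2) ∧
          msup (F.P K).L (K - n) (((F.L : ℝ)⁻¹) ^ (K - n)) (-(2 : ℝ)) (fun j (t : Fin (F.P K).d × Fin (F.P K).d × LSite (F.P K).d) => SideTouches ((fun j => cubeFam false (F.P K).L a M' (ρ + M + F.L + S) (K - n) j) j) t.2.2 t.2.1)
              (fun t => covDerivFwd (((F.L : ℝ)⁻¹) ^ (K - n)) (1 : LSite (F.P K).d → Fin (F.P K).d → ℂˣ) t.1 (fun z => φ z t.2.1) t.2.2)
            ≤ B₀ * (bondNorm (F.P K).L (K - n) (((F.L : ℝ)⁻¹) ^ (K - n)) (-(3 : ℝ)) (fun j => cubeFam false (F.P K).L a M' (ρ + M + F.L + S) (K - n) j) (fun x μ => Jcur (((F.L : ℝ)⁻¹) ^ (K - n)) (1 : LSite (F.P K).d → Fin (F.P K).d → ℂˣ) φ μ x)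
              + wsup 1 (fun p : {p : ℕ × (LSite (F.P K).d × Fin (F.P K).d) // p.1 ≤ K - n ∧ (p.2 ∈ (fun j => cubeLamBP (F.P K).L a M' (ρ + M + F.L + S) (K - n) (K - n) j) p.1 ∨ (p.1 = 0 ∧ CrossB ((fun j => cubeFam false (F.P K).L a M' (ρ + M + F.L + S) (K - n) j) 0) p.2))} =>
                  linCovIter (F.P K).L (1 : LSite (F.P K).d → Fin (F.P K).d → ℂˣ) (iEta (((F.L : ℝ)⁻¹) ^ (K - n)) φ) p.1.1 p.1.2.1 p.1.2.2))
              + Bbd * msup (F.P K).L (K - n) (((F.L : ℝ)⁻¹) ^ (K - n)) (-(1 : ℝ)) (fun j (b : LSite (F.P K).d × Fin (F.P K).d) => j = 0 ∧ SideTouches ((fun j => cubeFam false (F.P K).L a M' (ρ + M + F.L + S) (K - n) j) 0) b.1 b.2 ∧ ¬ BondTouches ((fun j => cubeFam false (F.P K).L a M' (ρ + M + F.L + S) (K - n) j) 0) b.1 b.2)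
                  (fun b => φ b.1 b.2) := by
      intro φ hLanφ hsuppφ
      obtain ⟨q1, q2, -, -⟩ := H _ hη a M' (ρ + M + F.L + S) (K - n) sx Rx hk hρL hM₀ hdρ hdM hRρ hR₀ hN₀ hρ₀ (K - n) hk le_rfl
        (fun j c => c ∈ cubeLamBP (F.P K).L a M' (ρ + M + F.L + S) (K - n) (K - n) j ∨ (j = 0 ∧ CrossB (cubeFam false (F.P K).L a M' (ρ + M + F.L + S) (K - n) 0) c))
        (fun j _ c hc => Or.inl hc) φ hLanφ hsuppφ
      exact twoLine_mono (msup_nonneg _ _ hη.le _ _ _) (wsup_nonneg zero_le_one _) (msup_nonneg _ _ hη.le _ _ _) hB hBbd ⟨q1, q2⟩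
    exact flat159_clause_of_scalar_bdryβ (𝔸 := Matrix (Fin 2) (Fin 2) ℂ) (d := (F.P K).d) (by rw [T3Family.P_d]; norm_num) hL1 hη (K - n)
      (fun j => cubeFam false (F.P K).L a M' (ρ + M + F.L + S) (K - n) j) (cubeLamS (F.P K).L a M' (ρ + M + F.L + S) (K - n) (K - n))
      (fun j => cubeLamBP (F.P K).L a M' (ρ + M + F.L + S) (K - n) (K - n) j) (le_trans zero_le_one (hB₀l.trans hB)) (le_trans zero_le_one (hB₀l.trans hBbd)) hc0 hc
      SCALAR V' A' hLan.1 h41 h0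
  · -- no member has an even `L`
    refine ⟨1, 0, 0, 0, 0, le_rfl, fun M' B₀ B₀'H B₂' BG BR cB9 Bbd _ _ _ _ _ _ _ F hF => ?_⟩
    exact absurd (hF ▸ F.hL.1) hodd

end Summit.QuantumFields.YangMills.Theorems.HalvingH59GammaDischargeFlat

end
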